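import Summits.ResolutionOfSingularities.ResolutionOfSingularities.Theorems.FrobeniusLadderFInjectiveMacaulayficationQ6OffOrigin
import Mathlib.Algebra.MvPolynomial.Rename
import HarnessLib

/-!
# Q6-LINE: the cylinder `V(f₂) × 𝔸¹` is regular off its axis in characteristic `5` — the `hoff′` input of the
# relative CN engine for the Q6-LINE calibration (crux `FInjectiveMacaulayfication`, chain w45a, §19 / R9.2)

Support file for crux stmt-ResolutionOfSingularities-15315 (`FrobeniusLadder.FInjectiveMacaulayfication`), chain w45a,
seat res-L1-w45a-stub-7 (= res-D-pv-019 after the D→L conversion). [OURS · L1 W4.5a] — NOT a statement of the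
manuscript under review; AI-written, weaker than expert review. Rulings of record: res-L1-w45a-plan-1 R9.2 («Q6-LINE :=
`strongPlusStep_cylinder_of_cnData` … modulo ONE hypothesis hoff′ (clause at maximal `Q` of `k[X_{n+1}]⧸(f′)` missing some
`x̄_{succ j}`)»), R7.3′ (Q6 hoff, `Q6OffOrigin` p500734).

The Q6-LINE is the first crux instance with a NON-ISOLATED bad locus: the cylinder over the Q6 specimen,

  `f′ = rename Fin.succ f₂ = X₁³X₂³ + X₁³X₃³ + X₂³X₃³ + X₃⁶ + X₁⁸ + X₂⁸ ∈ k[X₀, X₁, X₂, X₃]`, `char k = 5`,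

singular exactly along the axis `V(x̄₁, x̄₂, x̄₃) ≅ 𝔸¹`. The relative engine (`CNConeFiModelRel`, p497132/p497893; stub-5's
`…CNCylinder.lean`) needs the crux clause at every maximal ideal of `R′ = k[X]/(f′)` missing some `x̄_{succ j}`. As for the point
(`Q6OffOrigin`), we prove MORE: `R′_P` is REGULAR at every prime `P` missing some `x̄_{succ j}` (Jacobian criterion at an arbitrary
prime, `HypersurfaceRegular.stub_hypersurfaceRegularOfPderiv`, in a direction `succ j′` with `∂_{succ j′} f′ ∉ P ∩ k[X]`), because
the Jacobian ideal `(f′, ∂₁f′, ∂₂f′, ∂₃f′)` contains `X₁¹¹, X₂¹¹, X₃¹¹` — the SAME kernel certificates as for the point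
(`Q6JacobianCertX.x_pow_eleven_mem`, `Q6JacobianCertYZ.{y,z}_pow_eleven_mem`, p500304/p500323: stated for elements `x y z` of an
arbitrary commutative ring with `5 = 0`, here instantiated at `X 1, X 2, X 3 ∈ k[X_{Fin 4}]`; no second certificate).

* `offStratum_clause_of_regular` — GENERIC (any `p`, `n`, `f`, `J ⊆ Fin n`): regularity of `k[X]/(f)` at the primes missing some
  `x̄ⱼ`, `j ∈ J`, gives the relative engines' `hoff` clause at the maximal ideals missing some `x̄ⱼ`, `j ∈ J` (the `J`-relative
  form of `E8WeightedData.offOrigin_clause_of_regular`; reusable by every cylinder / linear-stratum calibration);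
* `regular_of_jacobian_pow_mem`, `offStratum_clause_of_jacobian_pow_mem` — GENERIC: if the Jacobian ideal `(f, ∂f)` contains a
  power of every `Xⱼ`, `j ∈ J`, then `k[X]/(f)` is regular at every prime missing some `x̄ⱼ` (`j ∈ J`) and (char `p`) the clause holds
  at every such maximal ideal — the one-call form: a specimen file only supplies the kernel certificate;
* `rename_succ_q6` — `rename Fin.succ f₂ = f′` (the two spellings of the cylinder agree);
* `pderiv_one_q6Line`, `pderiv_two_q6Line`, `pderiv_three_q6Line` — the partials of `f′` (any commutative ring);
* `X_succ_pow_eleven_mem_of_jacobian` — an ideal of `k[X_{Fin 4}]` (`char k = 5`) containing `f′, ∂₁f′, ∂₂f′, ∂₃f′` contains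
  every `X_{succ j}¹¹`;
* `q6Line_jacobian_pow_mem` — the certificate in the generic shape; `q6Line_regular_of_not_mem` — `R′_P` is regular for every prime `P` of `R′` with some `x̄_{succ j} ∉ P`;
* `q6Line_offAxis_clause_char5` — hoff′: the crux clause (`p = 5`) at every maximal `Q` of `R′` with some `x̄_{succ j} ∉ Q`,
  VERBATIM in the shape of the engines' `hoff` binders; `q6Line_offAxis_clause_char5'` — the same for `f′` spelled
  `rename Fin.succ f₂`.

No definitions, no named facts, no `sorry`. [folklore]
-/

-- single-problem summit: the doubled namespace component is forced
set_option linter.dupNamespace false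

noncomputable section

namespace Summit.ResolutionOfSingularities.ResolutionOfSingularities.Theorems.FInjectiveMacaulayfication.Q6LineOffAxis

open MvPolynomial

/-! ## The two spellings of the cylinder and its partial derivatives -/

/-- **`rename Fin.succ f₂ = f′`**: shifting the variables of `f₂ = X₀³X₁³ + X₀³X₂³ + X₁³X₂³ + X₂⁶ + X₀⁸ + X₁⁸` by `Fin.succ`
gives `X₁³X₂³ + X₁³X₃³ + X₂³X₃³ + X₃⁶ + X₁⁸ + X₂⁸` in `k[X₀,…,X₃]` (any commutative ring). [folklore] -/
theorem rename_succ_q6 {A : Type*} [CommRing A] :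
    rename Fin.succ (X 0 ^ 3 * X 1 ^ 3 + X 0 ^ 3 * X 2 ^ 3 + X 1 ^ 3 * X 2 ^ 3 + X 2 ^ 6 + X 0 ^ 8 + X 1 ^ 8 :
      MvPolynomial (Fin 3) A) =
      (X 1 ^ 3 * X 2 ^ 3 + X 1 ^ 3 * X 3 ^ 3 + X 2 ^ 3 * X 3 ^ 3 + X 3 ^ 6 + X 1 ^ 8 + X 2 ^ 8 :
        MvPolynomial (Fin 4) A) := by
  simp only [map_add, map_mul, map_pow, rename_X]
  rfl

/-- **`∂f′/∂X₁ = 8X₁⁷ + 3X₁²X₂³ + 3X₁²X₃³`**, over any commutative ring. [folklore] -/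
theorem pderiv_one_q6Line {A : Type*} [CommRing A] :
    pderiv 1 (X 1 ^ 3 * X 2 ^ 3 + X 1 ^ 3 * X 3 ^ 3 + X 2 ^ 3 * X 3 ^ 3 + X 3 ^ 6 + X 1 ^ 8 + X 2 ^ 8 :
      MvPolynomial (Fin 4) A) = 8 * X 1 ^ 7 + 3 * X 1 ^ 2 * X 2 ^ 3 + 3 * X 1 ^ 2 * X 3 ^ 3 := by
  simp only [map_add, pderiv_mul, pderiv_pow, pderiv_X_self, pderiv_X_of_ne (show (2 : Fin 4) ≠ 1 by decide),
    pderiv_X_of_ne (show (3 : Fin 4) ≠ 1 by decide), mul_zero, zero_mul, add_zero, mul_one]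
  push_cast
  ring

/-- **`∂f′/∂X₂ = 3X₁³X₂² + 8X₂⁷ + 3X₂²X₃³`**, over any commutative ring. [folklore] -/
theorem pderiv_two_q6Line {A : Type*} [CommRing A] :
    pderiv 2 (X 1 ^ 3 * X 2 ^ 3 + X 1 ^ 3 * X 3 ^ 3 + X 2 ^ 3 * X 3 ^ 3 + X 3 ^ 6 + X 1 ^ 8 + X 2 ^ 8 :
      MvPolynomial (Fin 4) A) = 3 * X 1 ^ 3 * X 2 ^ 2 + 8 * X 2 ^ 7 + 3 * X 2 ^ 2 * X 3 ^ 3 := by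
  simp only [map_add, pderiv_mul, pderiv_pow, pderiv_X_self, pderiv_X_of_ne (show (1 : Fin 4) ≠ 2 by decide),
    pderiv_X_of_ne (show (3 : Fin 4) ≠ 2 by decide), mul_zero, zero_mul, add_zero, zero_add, mul_one]
  push_cast
  ring

/-- **`∂f′/∂X₃ = 3X₁³X₃² + 3X₂³X₃² + 6X₃⁵`**, over any commutative ring. [folklore] -/
theorem pderiv_three_q6Line {A : Type*} [CommRing A] :
    pderiv 3 (X 1 ^ 3 * X 2 ^ 3 + X 1 ^ 3 * X 3 ^ 3 + X 2 ^ 3 * X 3 ^ 3 + X 3 ^ 6 + X 1 ^ 8 + X 2 ^ 8 :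
      MvPolynomial (Fin 4) A) = 3 * X 1 ^ 3 * X 3 ^ 2 + 3 * X 2 ^ 3 * X 3 ^ 2 + 6 * X 3 ^ 5 := by
  simp only [map_add, pderiv_mul, pderiv_pow, pderiv_X_self, pderiv_X_of_ne (show (1 : Fin 4) ≠ 3 by decide),
    pderiv_X_of_ne (show (2 : Fin 4) ≠ 3 by decide), mul_zero, zero_mul, add_zero, zero_add, mul_one]
  push_cast
  ring

/-! ## Generic: regularity off a coordinate stratum gives the engines' relative `hoff` clause -/

/-- **Off-stratum regularity ⇒ the relative off-stratum clause** (the `J`-relative form of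
`E8WeightedData.offOrigin_clause_of_regular`, for every cylinder / linear-stratum calibration of the relative engines
`CNConeFiModelRel` / `GradedConeFiModelRel`): if `R = k[X_{Fin n}]/(f)` (`char k = p`) is regular at every PRIME missing some `x̄ⱼ`,
`j ∈ J`, then at every MAXIMAL ideal missing some `x̄ⱼ`, `j ∈ J`, every system of parameters of the local ring is weakly regular
and every parameter ideal is Frobenius closed (`FiClauseOfRegular.stub_fiClauseOfRegular`). [folklore] -/
theorem offStratum_clause_of_regular (p : ℕ) [Fact p.Prime] (k : Type) [Field k] [CharP k p] {n : ℕ}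
    (f : MvPolynomial (Fin n) k) (J : Finset (Fin n))
    (hreg : ∀ (P : Ideal (MvPolynomial (Fin n) k ⧸ Ideal.span {f})) [P.IsPrime],
      (∃ j ∈ J, Ideal.Quotient.mk (Ideal.span {f}) (MvPolynomial.X j) ∉ P) → IsRegularLocalRing (Localization.AtPrime P)) :
    ∀ (Q : Ideal (MvPolynomial (Fin n) k ⧸ Ideal.span {f})) [Q.IsMaximal],
      (∃ j ∈ J, Ideal.Quotient.mk (Ideal.span {f}) (MvPolynomial.X j) ∉ Q) →
      ∀ d : ℕ, ringKrullDim (Localization.AtPrime Q) = d → ∀ s : Fin d → Localization.AtPrime Q,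
        (Ideal.span (Set.range s)).radical.IsMaximal →
          RingTheory.Sequence.IsWeaklyRegular (Localization.AtPrime Q) (List.ofFn s) ∧
          ∀ y : Localization.AtPrime Q, (∃ e : ℕ, y ^ p ^ e ∈ Ideal.span
            ((fun z : Localization.AtPrime Q => z ^ p ^ e) ''
              (Ideal.span (Set.range s) : Set (Localization.AtPrime Q)))) → y ∈ Ideal.span (Set.range s) := by
  intro Q _ hQ
  haveI : IsRegularLocalRing (Localization.AtPrime Q) := hreg Q hQ
  by_cases htriv : Nontrivial (MvPolynomial (Fin n) k ⧸ Ideal.span {f}); swap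
  · exfalso
    rw [not_nontrivial_iff_subsingleton] at htriv
    exact Ideal.IsMaximal.ne_top ‹Q.IsMaximal› (Subsingleton.elim _ _)
  haveI : CharP (MvPolynomial (Fin n) k ⧸ Ideal.span {f}) p :=
    charP_of_injective_algebraMap (algebraMap k (MvPolynomial (Fin n) k ⧸ Ideal.span {f})).injective p
  haveI : CharP (Localization.AtPrime Q) p := DegreeZeroDescent.charP_localization_atPrime p Q
  exact (FiClauseOfRegular.stub_fiClauseOfRegular p (Localization.AtPrime Q)).2

/-- **Jacobian ideal containing powers of the `J`-variables ⇒ regular off the stratum `V(X_J)`** (generic; the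
specimen-independent half of every «isolated along a coordinate stratum» hoff computation): if for every `j ∈ J` some power
`Xⱼᴺ` lies in the Jacobian ideal `(f, ∂₀f, …, ∂_{n-1}f)` of `f ∈ k[X_{Fin n}]`, then `(k[X]/(f))_P` is regular at every prime `P`
missing some `x̄ⱼ`, `j ∈ J`: not all `∂ᵢf` lie in `P₀ = P ∩ k[X]` (else `Xⱼᴺ ∈ P₀ ∋ f`, so `x̄ⱼ ∈ P`), and the Jacobian criterion at
an arbitrary prime (`HypersurfaceRegular.stub_hypersurfaceRegularOfPderiv`, Matsumura 30.4 (ii)) applies in a direction `i` with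
`∂ᵢf ∉ P₀`. [folklore] -/
theorem regular_of_jacobian_pow_mem (k : Type) [Field k] {n : ℕ} (f : MvPolynomial (Fin n) k) (J : Finset (Fin n))
    (hJ : ∀ j ∈ J, ∃ N : ℕ, (MvPolynomial.X j : MvPolynomial (Fin n) k) ^ N ∈
      Ideal.span ({f} ∪ Set.range fun i : Fin n => pderiv i f))
    (P : Ideal (MvPolynomial (Fin n) k ⧸ Ideal.span {f})) [P.IsPrime]
    (hP : ∃ j ∈ J, Ideal.Quotient.mk (Ideal.span {f}) (MvPolynomial.X j) ∉ P) :
    IsRegularLocalRing (Localization.AtPrime P) := by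
  haveI hprime : (P.comap (Ideal.Quotient.mk (Ideal.span {f}))).IsPrime := Ideal.comap_isPrime _ _
  have hfP : f ∈ P.comap (Ideal.Quotient.mk (Ideal.span {f})) := by
    rw [Ideal.mem_comap, Ideal.Quotient.eq_zero_iff_mem.mpr (Ideal.mem_span_singleton_self f)]
    exact P.zero_mem
  by_cases hd : ∃ i : Fin n, pderiv i f ∉ P.comap (Ideal.Quotient.mk (Ideal.span {f}))
  · obtain ⟨i, hi⟩ := hd
    exact HypersurfaceRegular.stub_hypersurfaceRegularOfPderiv k n f i P hi
  · -- every partial vanishes on `P₀`: the Jacobian ideal sits inside `P₀`, hence so does some power of each `Xⱼ`, `j ∈ J`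
    exfalso
    simp only [not_exists, not_not] at hd
    have hle : Ideal.span ({f} ∪ Set.range fun i : Fin n => pderiv i f) ≤ P.comap (Ideal.Quotient.mk (Ideal.span {f})) := by
      rw [Ideal.span_le]
      rintro g (hg | ⟨i, rfl⟩)
      · rw [Set.mem_singleton_iff.mp hg]; exact hfP
      · exact hd i
    obtain ⟨j, hj, hjP⟩ := hP
    obtain ⟨N, hN⟩ := hJ j hj
    exact hjP (Ideal.mem_comap.mp (hprime.mem_of_pow_mem N (hle hN)))

/-- **Jacobian ideal containing powers of the `J`-variables ⇒ the relative off-stratum clause** (characteristic `p`):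
`regular_of_jacobian_pow_mem` followed by `offStratum_clause_of_regular`. This is the one-call form for specimen files: the only
specimen-specific input is the kernel certificate `∀ j ∈ J, ∃ N, Xⱼᴺ ∈ (f, ∂f)`. [folklore] -/
theorem offStratum_clause_of_jacobian_pow_mem (p : ℕ) [Fact p.Prime] (k : Type) [Field k] [CharP k p] {n : ℕ}
    (f : MvPolynomial (Fin n) k) (J : Finset (Fin n))
    (hJ : ∀ j ∈ J, ∃ N : ℕ, (MvPolynomial.X j : MvPolynomial (Fin n) k) ^ N ∈
      Ideal.span ({f} ∪ Set.range fun i : Fin n => pderiv i f)) :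
    ∀ (Q : Ideal (MvPolynomial (Fin n) k ⧸ Ideal.span {f})) [Q.IsMaximal],
      (∃ j ∈ J, Ideal.Quotient.mk (Ideal.span {f}) (MvPolynomial.X j) ∉ Q) →
      ∀ d : ℕ, ringKrullDim (Localization.AtPrime Q) = d → ∀ s : Fin d → Localization.AtPrime Q,
        (Ideal.span (Set.range s)).radical.IsMaximal →
          RingTheory.Sequence.IsWeaklyRegular (Localization.AtPrime Q) (List.ofFn s) ∧
          ∀ y : Localization.AtPrime Q, (∃ e : ℕ, y ^ p ^ e ∈ Ideal.span
            ((fun z : Localization.AtPrime Q => z ^ p ^ e) ''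
              (Ideal.span (Set.range s) : Set (Localization.AtPrime Q)))) → y ∈ Ideal.span (Set.range s) :=
  offStratum_clause_of_regular p k f J (fun P _ hP => regular_of_jacobian_pow_mem k f J hJ P hP)

/-! ## The Jacobian ideal of the cylinder, regularity off the axis, and the `hoff′` clause -/

/-- **The Jacobian ideal of `f′` contains `X₁¹¹, X₂¹¹, X₃¹¹` in characteristic `5`**: every ideal `I ⊆ k[X₀,…,X₃]`
(`char k = 5`) containing `f′ = X₁³X₂³ + X₁³X₃³ + X₂³X₃³ + X₃⁶ + X₁⁸ + X₂⁸` and `∂₁f′, ∂₂f′, ∂₃f′` contains `X_{succ j}¹¹` for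
`j : Fin 3` — the certificates of `Q6JacobianCertX` / `Q6JacobianCertYZ` at `x, y, z := X 1, X 2, X 3`. [folklore] -/
theorem X_succ_pow_eleven_mem_of_jacobian (k : Type) [Field k] [CharP k 5] (f' : MvPolynomial (Fin 4) k)
    (hf' : f' = X 1 ^ 3 * X 2 ^ 3 + X 1 ^ 3 * X 3 ^ 3 + X 2 ^ 3 * X 3 ^ 3 + X 3 ^ 6 + X 1 ^ 8 + X 2 ^ 8)
    (I : Ideal (MvPolynomial (Fin 4) k)) (hfI : f' ∈ I) (h1 : pderiv 1 f' ∈ I) (h2 : pderiv 2 f' ∈ I)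
    (h3 : pderiv 3 f' ∈ I) : ∀ j : Fin 3, (X j.succ : MvPolynomial (Fin 4) k) ^ 11 ∈ I := by
  have h5 := Q6OffOrigin.five_eq_zero k (n := 4)
  rw [hf'] at hfI h1 h2 h3
  rw [pderiv_one_q6Line] at h1
  rw [pderiv_two_q6Line] at h2
  rw [pderiv_three_q6Line] at h3
  intro j
  match j with
  | 0 => exact Q6JacobianCertX.x_pow_eleven_mem h5 I (X 1) (X 2) (X 3) hfI h1 h2 h3
  | 1 => exact Q6JacobianCertYZ.y_pow_eleven_mem h5 I (X 1) (X 2) (X 3) hfI h1 h2 h3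
  | 2 => exact Q6JacobianCertYZ.z_pow_eleven_mem h5 I (X 1) (X 2) (X 3) hfI h1 h2 h3

/-- **The Q6 cylinder's Jacobian certificate in the generic shape**: for `j : Fin 3`, `X_{succ j}¹¹` lies in the Jacobian
ideal `(f′, ∂₀f′, …, ∂₃f′)` of `f′` (`char k = 5`). [folklore] -/
theorem q6Line_jacobian_pow_mem (k : Type) [Field k] [CharP k 5] (f' : MvPolynomial (Fin 4) k)
    (hf' : f' = X 1 ^ 3 * X 2 ^ 3 + X 1 ^ 3 * X 3 ^ 3 + X 2 ^ 3 * X 3 ^ 3 + X 3 ^ 6 + X 1 ^ 8 + X 2 ^ 8) :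
    ∀ j ∈ (Finset.univ.image Fin.succ : Finset (Fin 4)), ∃ N : ℕ, (MvPolynomial.X j : MvPolynomial (Fin 4) k) ^ N ∈
      Ideal.span ({f'} ∪ Set.range fun i : Fin 4 => pderiv i f') := by
  intro i hi
  obtain ⟨j, -, rfl⟩ := Finset.mem_image.mp hi
  refine ⟨11, X_succ_pow_eleven_mem_of_jacobian k f' hf' _ (Ideal.subset_span (Or.inl rfl))
    (Ideal.subset_span (Or.inr ⟨1, rfl⟩)) (Ideal.subset_span (Or.inr ⟨2, rfl⟩)) (Ideal.subset_span (Or.inr ⟨3, rfl⟩)) j⟩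

/-- **The Q6 cylinder is regular off its axis in characteristic `5`**: for a field `k` of characteristic `5`,
`f′ = X₁³X₂³ + X₁³X₃³ + X₂³X₃³ + X₃⁶ + X₁⁸ + X₂⁸ ∈ S = k[X₀,…,X₃]`, `R′ = S/(f′)`, and a prime `P` of `R′` missing some `x̄_{succ j}`
(`j : Fin 3`), the local ring `R′_P` is regular (`regular_of_jacobian_pow_mem` with the certificate `q6Line_jacobian_pow_mem`).
[folklore] -/
theorem q6Line_regular_of_not_mem (k : Type) [Field k] [CharP k 5] (f' : MvPolynomial (Fin 4) k)
    (hf' : f' = X 1 ^ 3 * X 2 ^ 3 + X 1 ^ 3 * X 3 ^ 3 + X 2 ^ 3 * X 3 ^ 3 + X 3 ^ 6 + X 1 ^ 8 + X 2 ^ 8)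
    (P : Ideal (MvPolynomial (Fin 4) k ⧸ Ideal.span {f'})) [P.IsPrime]
    (hP : ∃ j : Fin 3, Ideal.Quotient.mk (Ideal.span {f'}) (X j.succ) ∉ P) :
    IsRegularLocalRing (Localization.AtPrime P) := by
  obtain ⟨j, hj⟩ := hP
  exact regular_of_jacobian_pow_mem k f' _ (q6Line_jacobian_pow_mem k f' hf') P
    ⟨j.succ, Finset.mem_image_of_mem _ (Finset.mem_univ j), hj⟩

/-- **Q6-LINE, characteristic `5`: the off-axis clause `hoff′`** — at every maximal ideal `Q` of `k[X₀,…,X₃]/(f′)` missing some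
`x̄_{succ j}` (`j : Fin 3`), every system of parameters of the local ring is weakly regular and every parameter ideal is
Frobenius closed (the local ring is regular by `q6Line_regular_of_not_mem`; regular local rings of characteristic `p` satisfy
the clause, `FiClauseOfRegular.stub_fiClauseOfRegular`). Shape = the `hoff` binder of `CNConeFiModel.cnConeFiModel` with the
witness variable restricted to the `succ`-range. [folklore] -/
theorem q6Line_offAxis_clause_char5 (k : Type) [Field k] [CharP k 5] (f' : MvPolynomial (Fin 4) k)
    (hf' : f' = MvPolynomial.X 1 ^ 3 * MvPolynomial.X 2 ^ 3 + MvPolynomial.X 1 ^ 3 * MvPolynomial.X 3 ^ 3 +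
        MvPolynomial.X 2 ^ 3 * MvPolynomial.X 3 ^ 3 + MvPolynomial.X 3 ^ 6 + MvPolynomial.X 1 ^ 8 + MvPolynomial.X 2 ^ 8) :
    ∀ (Q : Ideal (MvPolynomial (Fin 4) k ⧸ Ideal.span {f'})) [Q.IsMaximal],
      (∃ j : Fin 3, Ideal.Quotient.mk (Ideal.span {f'}) (MvPolynomial.X j.succ) ∉ Q) →
      ∀ d : ℕ, ringKrullDim (Localization.AtPrime Q) = d → ∀ s : Fin d → Localization.AtPrime Q,
        (Ideal.span (Set.range s)).radical.IsMaximal →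
          RingTheory.Sequence.IsWeaklyRegular (Localization.AtPrime Q) (List.ofFn s) ∧
          ∀ y : Localization.AtPrime Q, (∃ e : ℕ, y ^ 5 ^ e ∈ Ideal.span
            ((fun z : Localization.AtPrime Q => z ^ 5 ^ e) ''
              (Ideal.span (Set.range s) : Set (Localization.AtPrime Q)))) → y ∈ Ideal.span (Set.range s) := by
  intro Q _ hQ
  haveI : Fact (Nat.Prime 5) := ⟨Nat.prime_five⟩
  obtain ⟨j, hj⟩ := hQ
  exact offStratum_clause_of_jacobian_pow_mem 5 k f' _ (q6Line_jacobian_pow_mem k f' hf') Q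
    ⟨j.succ, Finset.mem_image_of_mem _ (Finset.mem_univ j), hj⟩

/-- **Q6-LINE `hoff′`, `rename` spelling**: the same clause for the cylinder written `rename Fin.succ f₂` with `f₂` in the
normal form of `stub_q6CNFiModel_char5` (`L/w45a/Stubs-v19.lean` §1). [folklore] -/
theorem q6Line_offAxis_clause_char5' (k : Type) [Field k] [CharP k 5] (f : MvPolynomial (Fin 3) k)
    (hf : f = MvPolynomial.X 0 ^ 3 * MvPolynomial.X 1 ^ 3 + MvPolynomial.X 0 ^ 3 * MvPolynomial.X 2 ^ 3 +
        MvPolynomial.X 1 ^ 3 * MvPolynomial.X 2 ^ 3 + MvPolynomial.X 2 ^ 6 + MvPolynomial.X 0 ^ 8 + MvPolynomial.X 1 ^ 8)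
    (f' : MvPolynomial (Fin 4) k) (hf' : f' = rename Fin.succ f) :
    ∀ (Q : Ideal (MvPolynomial (Fin 4) k ⧸ Ideal.span {f'})) [Q.IsMaximal],
      (∃ j : Fin 3, Ideal.Quotient.mk (Ideal.span {f'}) (MvPolynomial.X j.succ) ∉ Q) →
      ∀ d : ℕ, ringKrullDim (Localization.AtPrime Q) = d → ∀ s : Fin d → Localization.AtPrime Q,
        (Ideal.span (Set.range s)).radical.IsMaximal →
          RingTheory.Sequence.IsWeaklyRegular (Localization.AtPrime Q) (List.ofFn s) ∧
          ∀ y : Localization.AtPrime Q, (∃ e : ℕ, y ^ 5 ^ e ∈ Ideal.span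
            ((fun z : Localization.AtPrime Q => z ^ 5 ^ e) ''
              (Ideal.span (Set.range s) : Set (Localization.AtPrime Q)))) → y ∈ Ideal.span (Set.range s) := by
  rw [hf, rename_succ_q6] at hf'
  exact q6Line_offAxis_clause_char5 k f' hf'

end Summit.ResolutionOfSingularities.ResolutionOfSingularities.Theorems.FInjectiveMacaulayfication.Q6LineOffAxis

end
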